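import Summits.BirchSwinnertonDyer.BirchSwinnertonDyer.Theorems.PrintCf2RamifiedOffTYZPartnerShaSelmerR2
import HarnessLib

/-!
# Crux `PrintCf2.RamifiedOffTYZOfFacts` (stmt-BirchSwinnertonDyer-20509), line `offtyz-v7`, LEAD cycle 24 (cruxlead-20509 g23), part 1/3:
# THE `φ̂`-SELMER GROUP ON THE SECTOR R1 — `dim S(0, −l²m²) = 3` for `n = lm`, `l ≡ 1`, `m ≡ 5 (mod 8)`, `(l/m) = +1`

THEOREMS ONLY (no `def`, no named fact, no `sorry`), `--supports stmt-BirchSwinnertonDyer-20509`.  HONEST FRAMING: cruxlead g20's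
HEADLINE «`Ш(A_n)[2] = 0 ⟺ ρ(n) ≠ 0 ∧ #Sel₄(E_n) = 2⁶`» (`…PartnerShaRigidity`, the lineage's first theorems CONSUMING the hypothesis
`#Sel₄(E_n) = 2⁶` of C⁺ = item 23431) is stated on the abstract «two-prime shape» `dim S(0,−n²) = 3`, `dim S'(0,−n²) = 2` and was
instantiated (parts 5/6, `…PartnerShaSelmerR2{,Prime}`) only on the block-free sector R2 (`n = lq`, `q ≡ 7 (mod 8)`).  Category D with two odd
prime factors has ONE other sector — R1: `n = lm`, `l ≡ 1 (mod 8)`, `m ≡ 5 (mod 8)`, `(l/m) = (m/l) = +1` (`n ≡ 5 (mod 8)`, `s(n) = 3`;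
the sector of the lineage's census laws K1″ (876/876) and `RhoLawR1` (798/798), `Lines/offtyz_v7_LevelTwoR1Sketch.lean`) — on which no kernel
theorem of the lineage computes anything.  This part proves the first of the two isogeny Selmer dimensions there.

* §11 `isLocallySoluble_diag_prime_negSq_of_emod_eight` — the local template of part 4 (`…DiagonalQuartics` §7) with the hypothesis
  `P ≡ ±1 (mod 8)` REPLACED by `R ≡ 1 (mod 8)`: for distinct primes `P ∉ {2,3}`, `R ≡ 1 (mod 8)`, `R` a square mod `P` and `P` a square
  mod `R`, `w² = P u⁴ − R²P z⁴` is everywhere locally soluble — at `2` the EXACT ZERO `u = √R ∈ ℤ₂` (`R ≡ 1 (mod 8)` is a `2`-adic square)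
  replaces the unit-square values `(1,0,√P)` / `(0,1,R√−P)`, which do not exist for `P ≡ 5 (mod 8)`.
* §12 `natCast_mem_twoIsogenySelmerGroup_R1` (`m, l ∈ S(0,−l²m²)`), and **`twoIsogenySelmerRank_R1` : `dim S(0, −l²m²) = 3`**
  (`Sel^{(φ̂)}(A_{lm} → E_{lm}) = {±1, ±l, ±m, ±lm}`: six explicit classes, `#S` a power of `2`, `#S ≤ 2^{ω+1} = 8`; the global classes
  `−1, ±lm` and the count are part 5's sector-free lemmas `torsion_mem_twoIsogenySelmerGroup_R2`, `card_primeFactors_R2`).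
Beyond-print theorem: NO (a routine `2`-isogeny descent).  BSD is not proved by any of this; C⁺ (23431) and the crux stay OPEN.

References: [cite: SilvermanAEC2009, Prop. X.4.9, Example X.4.10, Prop. X.6.2(b)]; [cite: SilvermanTate2015, §3.6]; [cite: TianYuanZhang2017, §1 (A_n, φ_n, ρ(n))];
tree: parts 4–6 of cycle 21 (`…PartnerSha{DiagonalQuartics,SelmerR2,SelmerR2Prime}`).
-/

noncomputable section

open scoped Classical

open WeierstrassCurve Literature.NumberTheory Literature.NumberTheory.EllipticCurves Literature.NumberTheory.DiophantineGeometry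
  Literature.NumberTheory.DiophantineGeometry.LindMordellQuartics Literature.NumberTheory.EllipticCurves.TianYuanZhang2017

namespace Summit.BirchSwinnertonDyer.PrintCf2.PartnerSha

/-- `b / d = d'` from `d · d' = b`. [folklore] -/
private theorem ediv_eq_of_mul_eq_left {b d d' : ℤ} (hd : d ≠ 0) (h : d * d' = b) : b / d = d' := by
  rw [← h, Int.mul_ediv_cancel_left _ hd]

/-- A prime `≥ 5` is what remains after excluding `2` and `3`. [folklore] -/
private theorem five_le_of_prime_ne {p : ℕ} (hp : p.Prime) (h2 : p ≠ 2) (h3 : p ≠ 3) : 5 ≤ p := by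
  by_contra h
  interval_cases p <;> first | exact absurd hp (by decide) | omega

/-- Residues mod `3` of a prime `≠ 3`. [folklore] -/
private theorem mod_three_of_prime_ne_three {p : ℕ} (hp : p.Prime) (h3 : p ≠ 3) : p % 3 = 1 ∨ p % 3 = 2 := by
  have : p % 3 ≠ 0 := fun h0 => by
    have h := (Nat.dvd_prime hp).mp (Nat.dvd_of_mod_eq_zero h0)
    omega
  omega

/-! ## §11 The template `w² = P u⁴ − R²P z⁴` when `R ≡ 1 (mod 8)` (any odd `P ≠ 3`) -/

/-- **The diagonal class `w² = P u⁴ − R² P z⁴` is everywhere locally soluble** for distinct primes `P ∉ {2, 3}` and `R ≡ 1 (mod 8)`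
with `R` a square mod `P` and `P` a square mod `R`: at `P` AND at `2` the exact zero `u = √R` (`√R ∈ ℤ_P` by `(R/P) = 1`, `√R ∈ ℤ₂`
since `R ≡ 1 (mod 8)`; `P(u⁴ − R²) = 0`), at `R` the point `(1, 0, √P)`, at `3` a unit square value, elsewhere good reduction.  This is
part 4's `isLocallySoluble_diag_prime_negSq` with `P ≡ ±1 (mod 8)` traded for `R ≡ 1 (mod 8)` — the form needed for the class `m ≡ 5 (mod 8)`
of `Sel^{(φ̂)}` on R1. [cite: SilvermanAEC2009, Prop. X.4.9, Example X.4.10 (method)] -/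
theorem isLocallySoluble_diag_prime_negSq_of_emod_eight {P R : ℕ} [hPp : Fact P.Prime] [hRp : Fact R.Prime] (hPR : P ≠ R)
    (hP2 : P ≠ 2) (hP3 : P ≠ 3) (hR8 : R % 8 = 1)
    (hRP : IsSquare ((R : ℤ) : ZMod P)) (hPRsq : IsSquare ((P : ℤ) : ZMod R)) :
    (⟨P, 0, 0, 0, -((R : ℤ) ^ 2 * P)⟩ : BinaryQuartic ℤ).IsLocallySoluble := by
  have hP := hPp.out
  have hR := hRp.out
  have hR2 : R ≠ 2 := by rintro rfl; omega
  have hR3 : R ≠ 3 := by rintro rfl; omega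
  have hPnR : ¬ (P : ℤ) ∣ R := by
    intro h
    have := (Nat.prime_dvd_prime_iff_eq hP hR).mp (by exact_mod_cast h)
    exact hPR this
  have hRnP : ¬ (R : ℤ) ∣ P := by
    intro h
    have := (Nat.prime_dvd_prime_iff_eq hR hP).mp (by exact_mod_cast h)
    exact hPR this.symm
  refine ⟨?_, fun p hp => ?_⟩
  · -- real: `P > 0`
    have := isSoluble_real_twoIsogenyQuartic_of_pos (d := P) (by exact_mod_cast hP.pos) 0 (-((R : ℤ) ^ 2 * P))
    rwa [twoIsogenyQuartic_zero] at this
  · have hpP := hp.out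
    by_cases hpeqP : p = P
    · -- `p = P`: the zero `(√R, 1, 0)`
      subst hpeqP
      obtain ⟨s, hs⟩ := exists_sq_eq_intCast_of_isSquare hP2 hPnR hRP
      refine isSoluble_padic_diag_of_point (x := s) (y := 1) (z := 0) (Or.inr one_ne_zero) ?_
      have hs4 : s ^ 4 = ((R : ℤ) : ℤ_[p]) ^ 2 := by rw [← hs]; ring
      rw [hs4]; push_cast; ring
    by_cases hpeqR : p = R
    · -- `p = R`: the point `(1, 0, √P)`
      subst hpeqR
      obtain ⟨r, hr⟩ := exists_sq_eq_intCast_of_isSquare hR2 hRnP hPRsq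
      exact isSoluble_padic_diag_of_point (x := 1) (y := 0) (z := r) (Or.inl one_ne_zero)
        (by rw [hr]; push_cast; ring)
    by_cases hp2 : p = 2
    · -- `p = 2`: the zero `(√R, 1, 0)`, `R ≡ 1 (mod 8)` a `2`-adic square
      subst hp2
      obtain ⟨s, hs⟩ := exists_sq_eq_two_of_emod_eight (c := R) (by exact_mod_cast (show (R : ℤ) % 8 = 1 by omega))
      refine isSoluble_padic_diag_of_point (x := s) (y := 1) (z := 0) (Or.inr one_ne_zero) ?_
      have hs4 : s ^ 4 = ((R : ℤ) : ℤ_[2]) ^ 2 := by rw [← hs]; ring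
      rw [hs4]; push_cast; ring
    by_cases hp3 : p = 3
    · subst hp3
      rcases mod_three_of_prime_ne_three hP hP3 with h1 | h2
      · -- `(1, 0, √P)`, `P ≡ 1 (mod 3)`
        obtain ⟨r, hr⟩ := exists_sq_eq_intCast (q := 3) (by norm_num) (c := P) (w := 1) (by norm_num)
          (by omega)
        exact isSoluble_padic_diag_of_point (x := 1) (y := 0) (z := r) (Or.inl one_ne_zero)
          (by rw [hr]; push_cast; ring)
      · -- `(0, 1, √(−R²P))`, `P ≡ 2 (mod 3)`
        obtain ⟨r, hr⟩ := exists_sq_eq_intCast (q := 3) (by norm_num) (c := -((R : ℤ) ^ 2 * P)) (w := 1)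
          (by norm_num) (three_dvd_neg_sq_mul_sub_one h2 (mod_three_of_prime_ne_three hR hR3))
        exact isSoluble_padic_diag_of_point (x := 0) (y := 1) (z := r) (Or.inr one_ne_zero)
          (by rw [hr]; push_cast; ring)
    · -- good reduction at `p ≥ 5`, `p ∉ {P, R}`
      have hp5 := five_le_of_prime_ne hpP hp2 hp3
      have hpi : Prime (p : ℤ) := Nat.prime_iff_prime_int.mp hpP
      have hpnP : ¬ (p : ℤ) ∣ P := fun h =>
        hpeqP ((Nat.prime_dvd_prime_iff_eq hpP hP).mp (by exact_mod_cast h))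
      have hpnR : ¬ (p : ℤ) ∣ R := fun h =>
        hpeqR ((Nat.prime_dvd_prime_iff_eq hpP hR).mp (by exact_mod_cast h))
      refine isSoluble_padic_diag_of_five_le hp5 hpnP ?_
      intro h
      rw [dvd_neg] at h
      rcases hpi.dvd_or_dvd h with h1 | h1
      · exact hpnR (hpi.dvd_of_dvd_pow h1)
      · exact hpnP h1

/-! ## §12 `Sel^{(φ̂)}(A_{lm} → E_{lm})` on R1: `dim S(0, −l²m²) = 3` -/

section R1

variable {l m : ℕ} [hlp : Fact l.Prime] [hmp : Fact m.Prime]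

/-- **`m, l ∈ Sel^{(φ̂)}` on R1.** For primes `l ≡ 1 (mod 8)`, `m ≡ 5 (mod 8)` with `(l/m) = (m/l) = 1`, the classes `m` and `l` lie in
`S(0, −l²m²)` (the descent on the divisors of `−n²` for `E_n = E_{0,−n²}`, `n = lm`): the class `l` by part 4's template (`l ≡ 1 (mod 8)`),
the class `m ≡ 5 (mod 8)` by §11 (the `2`-adic point is the exact zero `u = √l`). [cite: SilvermanAEC2009, Prop. X.4.9] -/
theorem natCast_mem_twoIsogenySelmerGroup_R1 (hl8 : l % 8 = 1) (hm8 : m % 8 = 5)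
    (hlm : IsSquare ((l : ℤ) : ZMod m)) (hml : IsSquare ((m : ℤ) : ZMod l)) :
    (m : ℤ) ∈ twoIsogenySelmerGroup 0 (-(((l * m : ℕ) : ℤ)) ^ 2) ∧
      (l : ℤ) ∈ twoIsogenySelmerGroup 0 (-(((l * m : ℕ) : ℤ)) ^ 2) := by
  have hl := hlp.out
  have hm := hmp.out
  have hlm_ne : l ≠ m := by rintro rfl; omega
  have hl2 : l ≠ 2 := by rintro rfl; omega
  have hl3 : l ≠ 3 := by rintro rfl; omega
  have hm2 : m ≠ 2 := by rintro rfl; omega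
  have hm3 : m ≠ 3 := by rintro rfl; omega
  have hb := hb_R2 (l := l) (q := m)
  constructor
  · rw [mem_twoIsogenySelmerGroup_iff hb]
    refine ⟨Int.squarefree_natCast.mpr hm.prime.squarefree, ⟨-((l : ℤ) ^ 2 * m), by push_cast; ring⟩, ?_⟩
    rw [ediv_eq_of_mul_eq_left (by exact_mod_cast hm.ne_zero) (d' := -((l : ℤ) ^ 2 * m)) (by push_cast; ring),
      twoIsogenyQuartic_zero]
    exact isLocallySoluble_diag_prime_negSq_of_emod_eight (Ne.symm hlm_ne) hm2 hm3 hl8 hlm hml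
  · rw [mem_twoIsogenySelmerGroup_iff hb]
    refine ⟨Int.squarefree_natCast.mpr hl.prime.squarefree, ⟨-((m : ℤ) ^ 2 * l), by push_cast; ring⟩, ?_⟩
    rw [ediv_eq_of_mul_eq_left (by exact_mod_cast hl.ne_zero) (d' := -((m : ℤ) ^ 2 * l)) (by push_cast; ring),
      twoIsogenyQuartic_zero]
    exact isLocallySoluble_diag_prime_negSq hlm_ne (Or.inl hl8) hm2 hm3 hml hlm

/-- **`dim S(0, −l²m²) = 3` on R1**: `Sel^{(φ̂)}(A_{lm} → E_{lm}) = {±1, ±l, ±m, ±lm}` has order `8` — six explicit classes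
(`1, −1, l, m, lm, −lm`), `#S` a power of `2` and `≤ 2^{ω+1} = 8`.  The SAME shape as on R2 (`twoIsogenySelmerRank_R2`).
[cite: SilvermanAEC2009, Prop. X.4.9] [cite: SilvermanTate2015, §3.6] -/
theorem twoIsogenySelmerRank_R1 (hl8 : l % 8 = 1) (hm8 : m % 8 = 5)
    (hlm : IsSquare ((l : ℤ) : ZMod m)) (hml : IsSquare ((m : ℤ) : ZMod l)) :
    twoIsogenySelmerRank 0 (-(((l * m : ℕ) : ℤ)) ^ 2) = 3 := by
  have hl := hlp.out
  have hm := hmp.out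
  have hlm_ne : l ≠ m := by rintro rfl; omega
  have hb := hb_R2 (l := l) (q := m)
  have hab : (-(((l * m : ℕ) : ℤ)) ^ 2) * ((0 : ℤ) ^ 2 - 4 * (-(((l * m : ℕ) : ℤ)) ^ 2)) ≠ 0 := by
    have : ((l * m : ℕ) : ℤ) ≠ 0 := by exact_mod_cast (Nat.mul_ne_zero hl.ne_zero hm.ne_zero)
    have h4 : (0 : ℤ) ^ 2 - 4 * (-(((l * m : ℕ) : ℤ)) ^ 2) = 4 * (((l * m : ℕ) : ℤ)) ^ 2 := by ring
    rw [h4]; positivity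
  obtain ⟨hmS, hlS⟩ := natCast_mem_twoIsogenySelmerGroup_R1 hl8 hm8 hlm hml
  obtain ⟨hm1, hn, hmn⟩ := torsion_mem_twoIsogenySelmerGroup_R2 (l := l) (q := m) hlm_ne
  have h1 := one_mem_twoIsogenySelmerGroup (0 : ℤ) hb
  -- six distinct members
  set T : Finset ℤ := {1, -1, (l : ℤ), (m : ℤ), ((l * m : ℕ) : ℤ), -((l * m : ℕ) : ℤ)} with hT
  have hl1 : 1 < l := hl.one_lt
  have hm1' : 1 < m := hm.one_lt
  have hTcard : T.card = 6 := by
    have hlmZ : ((l * m : ℕ) : ℤ) = (l : ℤ) * m := by push_cast; ring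
    have h1 : (1 : ℤ) < l := by exact_mod_cast hl1
    have h2 : (1 : ℤ) < m := by exact_mod_cast hm1'
    have h3 : (l : ℤ) ≠ m := by exact_mod_cast hlm_ne
    have h4 : (l : ℤ) < (l : ℤ) * m := by nlinarith
    have h5 : (m : ℤ) < (l : ℤ) * m := by nlinarith
    have key : ∀ N : ℤ, (l : ℤ) < N → (m : ℤ) < N →
        ({1, -1, (l : ℤ), (m : ℤ), N, -N} : Finset ℤ).card = 6 := by
      intro N hN1 hN2
      rw [Finset.card_insert_of_notMem (by simp only [Finset.mem_insert, Finset.mem_singleton]; omega),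
        Finset.card_insert_of_notMem (by simp only [Finset.mem_insert, Finset.mem_singleton]; omega),
        Finset.card_insert_of_notMem (by simp only [Finset.mem_insert, Finset.mem_singleton]; omega),
        Finset.card_insert_of_notMem (by simp only [Finset.mem_insert, Finset.mem_singleton]; omega),
        Finset.card_insert_of_notMem (by simp only [Finset.mem_singleton]; omega),
        Finset.card_singleton]
    rw [hT, hlmZ]
    exact key _ h4 h5
  have hsub : T ⊆ twoIsogenySelmerGroup 0 (-(((l * m : ℕ) : ℤ)) ^ 2) := by
    intro d hd
    simp only [hT, Finset.mem_insert, Finset.mem_singleton] at hd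
    rcases hd with rfl | rfl | rfl | rfl | rfl | rfl
    · exact h1
    · exact hm1
    · exact hlS
    · exact hmS
    · exact hn
    · exact hmn
  have h6 : 6 ≤ (twoIsogenySelmerGroup 0 (-(((l * m : ℕ) : ℤ)) ^ 2)).card := hTcard ▸ Finset.card_le_card hsub
  have h8 : (twoIsogenySelmerGroup 0 (-(((l * m : ℕ) : ℤ)) ^ 2)).card ≤ 8 := by
    have := card_twoIsogenySelmerGroup_le (0 : ℤ) hb
    rwa [card_primeFactors_R2 hlm_ne] at this
  obtain ⟨k, hk⟩ := exists_card_twoIsogenySelmerGroup_eq_two_pow hab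
  have hk3 : k = 3 := by
    rw [hk] at h6 h8
    rcases Nat.lt_or_ge k 3 with hlt | hge
    · interval_cases k <;> simp_all
    · rcases Nat.lt_or_ge k 4 with hlt4 | hge4
      · omega
      · have : 2 ^ 4 ≤ 2 ^ k := Nat.pow_le_pow_right two_pos hge4
        omega
  have h2 := two_pow_twoIsogenySelmerRank_eq_card hab
  rw [hk, hk3] at h2
  exact Nat.pow_right_injective le_rfl h2

end R1

end Summit.BirchSwinnertonDyer.PrintCf2.PartnerSha

end
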